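import Mathlib
import HarnessLib
import Literature.Barriers.QuantumFields.CenterSymmetryBreakingByQuarks
import Summits.Ventures.LatticeQCDFlow.TrivializingMaps.WilsonMeasureTrivializingMap
import Summits.Ventures.LatticeQCDFlow.Scaling.AutoregressiveGaugeAcceptanceCeiling

/-!
# LatticeQCDFlow / Scaling — the volume-uniform acceptance ceiling, INSTANCES: `SU(n)` (`n ≥ 2`) and
# `U(1)`, every `d ≥ 2`, `L ≥ 2`, `β > 0`: `ā ≤ 1 − ¼(1 − 8r²/n + 2 log φ(r)/((d−1)nβ))` for every `r > 0`

HONEST FRAMING: exact (Metropolis-corrected) sampling algorithms for lattice gauge theory;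
figures of merit are autocorrelation/cost numbers at stated couplings and volumes; no
continuum-physics claim.

Venture `LatticeQCDFlow` (cell pub-lqcd), topic `Scaling`, FANOUT row 30 (lean-1, GEN-19) — OUR WORK:
`Scaling/AutoregressiveGaugeAcceptanceCeiling` (`wilson_meanAccept_le_linkBall`, any compact group with a
continuous unitary representation having a non-trivial central scalar) specialised to the gauge group of
the venture, `SU(n)` in its defining representation (`StrongCoupling.defRep`), with the central element
`e^{2πi/n}·1 ∈ Z_n` (tree `Literature/…/CenterSymmetryBreakingByQuarks.scalarCenter`).

## What is proved

**`sun_meanAccept_le_linkBall`** [ours] — `n ≥ 2`, `d ≥ 2`, `L ≥ 2`, `β > 0`, `r > 0`; Wilson weight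
`e^{−βS_W}` of `SU(n)` on `(ℤ/L)^d`; a plaquette `p` with closing link `a`; ANY integrated set `s` inside
the links off the plaquette (the context of `a` contains its staple — e.g. `a` generated last); ANY bounded
measurable proposal density `Q` whose conditional at `a` is `q` (`A_sQ = q·A_{insert a s}Q`, `q ≥ 0`
normalised in `a`), `q` blind to the other links at one endpoint of `a`:
`ā ≤ 1 − ¼·(1 − 8r²/n + 2 log Haar{g ∈ SU(n) : ‖g − 1‖ ≤ r}/((d−1)nβ))`;
**`u1_meanAccept_le_linkBall`** — the same for `U(1)` (`Circle`, `u1Rep`, central element `−1`):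
`ā ≤ 1 − ¼·(1 − 8r² + 2 log Haar{g ∈ U(1) : ‖g − 1‖ ≤ r}/((d−1)β))`.

READING (value-free): for `SU(3)` in four dimensions an exact (Metropolis-corrected) sampler whose
autoregressive proposal generates some link after its staple from a conditioner that does not read the
links at one of the link's endpoints accepts at most `1 − ¼(1 − 8r²/3 + 2 log φ₃(r)/(9β))` of its
proposals, at every volume `L ≥ 2` and every `r > 0` — a ceiling tending to `3/4` as `β → ∞`.
NOT CLAIMED: any number at a specific `β` (the Haar small-ball mass `φ_n(r)` is not evaluated here);
conditioners reading both endpoints.  No `def`, no `sorry`, nothing cited as a fact beyond the tree.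
-/

noncomputable section

namespace Summit.Ventures.LatticeQCDFlow.Theory2.Autoregressive

open MeasureTheory Function Set
open Literature.MathematicalPhysics.QuantumFieldTheory Literature.MathematicalPhysics.QuantumLattice
open Summit.Ventures.LatticeQCDFlow.Exactness
open Summit.Ventures.LatticeQCDFlow.TrivializingMaps (StrongCoupling.defRep)
open scoped Matrix Matrix.Norms.Frobenius

variable {d L n : ℕ} [NeZero L]

set_option maxHeartbeats 400000 in
/-- **THE `SU(n)` ACCEPTANCE CEILING** (`n ≥ 2`, `d ≥ 2`, `L ≥ 2`, `β > 0`, every `r > 0`). [ours] -/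
theorem sun_meanAccept_le_linkBall (hn : 2 ≤ n) (hd : 2 ≤ d) (hL : 2 ≤ L) {β : ℝ} (hβ : 0 < β)
    {r : ℝ} (hr : 0 < r) (p : Plaquette d L) {s : Finset (Edge d L)}
    (hs : s ⊆ Finset.univ \
      {(p.1, p.2.1.1), (p.1.shift p.2.1.1, p.2.1.2), (p.1.shift p.2.1.2, p.2.1.1), (p.1, p.2.1.2)})
    {Q q : GaugeConfig d L (Matrix.specialUnitaryGroup (Fin n) ℂ) → ℝ} (hQm : Measurable Q)
    (hQ0 : ∀ U, 0 ≤ Q U) {CQ : ℝ} (hQb : ∀ U, Q U ≤ CQ)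
    (hQ1 : ∫ U, Q U ∂Measure.pi (fun _ : Edge d L =>
      haarProbability (Matrix.specialUnitaryGroup (Fin n) ℂ)) = 1)
    (hqm : Measurable q) (hq0 : ∀ U, 0 ≤ q U) {Cq : ℝ} (hqb : ∀ U, q U ≤ Cq)
    (hq1 : ∀ U, ∫ v, q (update U (p.1, p.2.1.1) v)
      ∂(haarProbability (Matrix.specialUnitaryGroup (Fin n) ℂ)) = 1)
    (hfac : ∀ U, coordAvg (haarProbability (Matrix.specialUnitaryGroup (Fin n) ℂ)) s Q U =
      q U * coordAvg (haarProbability (Matrix.specialUnitaryGroup (Fin n) ℂ)) (insert (p.1, p.2.1.1) s) Q U)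
    {y : Site d L} (hy : p.1 = y ∨ p.1.shift p.2.1.1 = y)
    (hqB : ∀ e : Edge d L, e.1 = y ∨ e.1.shift e.2 = y → e ≠ (p.1, p.2.1.1) →
      ∀ (U : GaugeConfig d L (Matrix.specialUnitaryGroup (Fin n) ℂ))
        (v : Matrix.specialUnitaryGroup (Fin n) ℂ), q (update U e v) = q U) :
    ∫ U, ∫ V, min
        (Real.exp (-β * wilsonAction (StrongCoupling.defRep n) U) /
            (∫ W, Real.exp (-β * wilsonAction (StrongCoupling.defRep n) W)
              ∂Measure.pi (fun _ : Edge d L => haarProbability (Matrix.specialUnitaryGroup (Fin n) ℂ))) *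
          Q V)
        (Real.exp (-β * wilsonAction (StrongCoupling.defRep n) V) /
            (∫ W, Real.exp (-β * wilsonAction (StrongCoupling.defRep n) W)
              ∂Measure.pi (fun _ : Edge d L => haarProbability (Matrix.specialUnitaryGroup (Fin n) ℂ))) *
          Q U)
        ∂Measure.pi (fun _ : Edge d L => haarProbability (Matrix.specialUnitaryGroup (Fin n) ℂ))
        ∂Measure.pi (fun _ : Edge d L => haarProbability (Matrix.specialUnitaryGroup (Fin n) ℂ)) ≤
      1 - (1 / 4) * (1 - 8 * r ^ 2 / n +
        2 * Real.log ((haarProbability (Matrix.specialUnitaryGroup (Fin n) ℂ)).real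
          {g : Matrix.specialUnitaryGroup (Fin n) ℂ | ‖(g : Matrix (Fin n) (Fin n) ℂ) - 1‖ ≤ r}) /
          (((d : ℝ) - 1) * n * β)) := by
  haveI : SecondCountableTopology (Matrix (Fin n) (Fin n) ℂ) :=
    inferInstanceAs (SecondCountableTopology (Fin n → Fin n → ℂ))
  haveI : SecondCountableTopology (Matrix.specialUnitaryGroup (Fin n) ℂ) :=
    Topology.IsEmbedding.subtypeVal.secondCountableTopology
  have hn0 : n ≠ 0 := by omega
  have hn1 : 1 ≤ n := by omega
  -- the central element `ω·1`, `ω = e^{2πi/n}`, a primitive `n`-th root of unity (`ω ≠ 1` as `n ≥ 2`)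
  set ω : ℂ := Complex.exp (2 * Real.pi * Complex.I / n) with hωdef
  have hprim : IsPrimitiveRoot ω n := Complex.isPrimitiveRoot_exp n hn0
  have hωn : ω ^ n = 1 := hprim.pow_eq_one
  have hne : ω ≠ 1 := hprim.ne_one (by omega)
  have hρ : Continuous (StrongCoupling.defRep n) := continuous_subtype_val
  have hρU : ∀ g : Matrix.specialUnitaryGroup (Fin n) ℂ,
      StrongCoupling.defRep n g ∈ Matrix.unitaryGroup (Fin n) ℂ := fun g =>
    Matrix.specialUnitaryGroup_le_unitaryGroup g.2
  have hω : StrongCoupling.defRep n (Literature.Barriers.QuantumFields.scalarCenter n ω hωn (by omega)) =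
      ω • (1 : Matrix (Fin n) (Fin n) ℂ) := rfl
  exact wilson_meanAccept_le_linkBall (StrongCoupling.defRep n) hd hn1 hρ hρU hL hω hne hβ hr p hs
    hQm hQ0 hQb hQ1 hqm hq0 hqb hq1 hfac hy hqB

set_option maxHeartbeats 400000 in
/-- **THE `U(1)` ACCEPTANCE CEILING** (`d ≥ 2`, `L ≥ 2`, `β > 0`, every `r > 0`; central element `−1`). [ours] -/
theorem u1_meanAccept_le_linkBall (hd : 2 ≤ d) (hL : 2 ≤ L) {β : ℝ} (hβ : 0 < β)
    {r : ℝ} (hr : 0 < r) (p : Plaquette d L) {s : Finset (Edge d L)}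
    (hs : s ⊆ Finset.univ \
      {(p.1, p.2.1.1), (p.1.shift p.2.1.1, p.2.1.2), (p.1.shift p.2.1.2, p.2.1.1), (p.1, p.2.1.2)})
    {Q q : GaugeConfig d L Circle → ℝ} (hQm : Measurable Q) (hQ0 : ∀ U, 0 ≤ Q U) {CQ : ℝ}
    (hQb : ∀ U, Q U ≤ CQ) (hQ1 : ∫ U, Q U ∂Measure.pi (fun _ : Edge d L => haarProbability Circle) = 1)
    (hqm : Measurable q) (hq0 : ∀ U, 0 ≤ q U) {Cq : ℝ} (hqb : ∀ U, q U ≤ Cq)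
    (hq1 : ∀ U, ∫ v, q (update U (p.1, p.2.1.1) v) ∂(haarProbability Circle) = 1)
    (hfac : ∀ U, coordAvg (haarProbability Circle) s Q U =
      q U * coordAvg (haarProbability Circle) (insert (p.1, p.2.1.1) s) Q U)
    {y : Site d L} (hy : p.1 = y ∨ p.1.shift p.2.1.1 = y)
    (hqB : ∀ e : Edge d L, e.1 = y ∨ e.1.shift e.2 = y → e ≠ (p.1, p.2.1.1) →
      ∀ (U : GaugeConfig d L Circle) (v : Circle), q (update U e v) = q U) :
    ∫ U, ∫ V, min
        (Real.exp (-β * wilsonAction u1Rep U) /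
            (∫ W, Real.exp (-β * wilsonAction u1Rep W) ∂Measure.pi (fun _ : Edge d L => haarProbability Circle)) *
          Q V)
        (Real.exp (-β * wilsonAction u1Rep V) /
            (∫ W, Real.exp (-β * wilsonAction u1Rep W) ∂Measure.pi (fun _ : Edge d L => haarProbability Circle)) *
          Q U)
        ∂Measure.pi (fun _ : Edge d L => haarProbability Circle) ∂Measure.pi (fun _ : Edge d L => haarProbability Circle) ≤
      1 - (1 / 4) * (1 - 8 * r ^ 2 +
        2 * Real.log ((haarProbability Circle).real {g : Circle | ‖u1Rep g - 1‖ ≤ r}) / (((d : ℝ) - 1) * β)) := by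
  have h := wilson_meanAccept_le_linkBall (d := d) (L := L) u1Rep hd le_rfl continuous_u1Rep
    u1Rep_mem_unitaryGroup hL u1Rep_neg_one (by norm_num) hβ hr p hs hQm hQ0 hQb hQ1 hqm hq0 hqb hq1 hfac hy hqB
  have e : (1 : ℝ) - 1 / 4 * (1 - 8 * r ^ 2 / ((1 : ℕ) : ℝ) +
      2 * Real.log ((haarProbability Circle).real {g : Circle | ‖u1Rep g - 1‖ ≤ r}) / (((d : ℝ) - 1) * ((1 : ℕ) : ℝ) * β)) =
      1 - 1 / 4 * (1 - 8 * r ^ 2 +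
        2 * Real.log ((haarProbability Circle).real {g : Circle | ‖u1Rep g - 1‖ ≤ r}) / (((d : ℝ) - 1) * β)) := by
    norm_num
  exact h.trans (le_of_eq e)

end Summit.Ventures.LatticeQCDFlow.Theory2.Autoregressive

end
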